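import Summits.FinalStateConjecture.FinalStateConjecture.Theses.RecedingSphereBudgets

/-!
# Route RecedingSphereBudgets · item `Assembly` (stmt-FinalStateConjecture-14743)

Pure logic. The route decl
`Summit.FinalStateConjecture.FinalStateConjecture.Theses.RecedingSphereBudgets.Assembly` reads
`ShapeSettledFinalEra → MassFreezing → SpinFreezing → Reanchoring → FinalStateConjecture`,
which is verbatim the type of the route's (sorry-free) deciding theorem
`Theses.RecedingSphereBudgets.closes`: Christodoulou genericity
`IsChristodoulouGeneric 𝓓 P 1` is antitone in the exceptional set, so the pointwise implication on
admissible data — for every MGHD `𝒟`, `ShapeSettledFinalEra` supplies complete `𝓘⁺` and the binders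
and clauses of the shape-settled final era `Q`, `MassFreezing` and `SpinFreezing` make every mass
and spin label converge under `Q`, and `Reanchoring` turns `Q` with convergent labels into the
Statement's `C²` final-state decomposition with sub-extremal holes and exhaustive charts —
transfers genericity from the hypothesis property to the Statement's property, the escaping
one-parameter families of `ShapeSettledFinalEra` serving verbatim. No hypothesis beyond the four
displayed ones enters; the proof is `closes` itself.

What is NOT here: any mathematics of the four cruxes (they are the route's open items
stmt-FinalStateConjecture-14737, -14736, -14738, -14740).
-/

-- `Summit.FinalStateConjecture.FinalStateConjecture.…` is the tree's mandated namespace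
-- (summit = sub-problem, D-0017 layout); the duplicate segment is deliberate.
set_option linter.dupNamespace false

namespace Summit.FinalStateConjecture.FinalStateConjecture.Theorems

/-- **Item `Assembly` (stmt-FinalStateConjecture-14743), route RecedingSphereBudgets.**
`ShapeSettledFinalEra → MassFreezing → SpinFreezing → Reanchoring → FinalStateConjecture`:
after unfolding, this is exactly the route's deciding theorem
`Theses.RecedingSphereBudgets.closes` (antitone-genericity transfer of the pointwise implication
shape-settled final era ⇒ frozen labels ⇒ re-anchored Statement decomposition on admissible data).
Pure logic; closes the assembly item. -/
theorem RecedingSphereBudgets.assembly_proof :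
    Summit.FinalStateConjecture.FinalStateConjecture.Theses.RecedingSphereBudgets.Assembly := by
  unfold Summit.FinalStateConjecture.FinalStateConjecture.Theses.RecedingSphereBudgets.Assembly
  exact Summit.FinalStateConjecture.FinalStateConjecture.Theses.RecedingSphereBudgets.closes

end Summit.FinalStateConjecture.FinalStateConjecture.Theorems
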